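import Summits.QuantumFields.YangMills.Theorems.LuscherReductionTwistedTraceScalingGaugeSliceKernel
import Summits.QuantumFields.YangMills.Theorems.LuscherReductionRunningReductionCoarseUpperCopies
import HarnessLib

/-!
# C4 INNER ONE-ORBIT ⇐ a min–max statement for the gauge-AVERAGED kernel on a TUBE, with NO gauge invariance left
# (lane A of S-BASE, crux `TwistedTraceScaling` stmt-QuantumFields-20203, sub-target C4 INNER; design note `pub/ym-fleet/ym-luscher-20007-p1/COARSE-DESIGN.md` §23)

THE NEW TARGET TEXT.  `TubeNoIntruderAt L T`: for every `k`, `ε > 0`, eventually in `β`, every family `f₀ … f_k` of bounded measurable functions (NO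
invariance asked) supported in the tube `T β ⊂ GaugeConfig 3 L SU2`, nondegenerate in `L²(N dU)` (`N = gaugeAvg 𝟙_{T β}`, the Faddeev–Popov weight), has a
nonzero combination `f = Σ aᵢ fᵢ` with
`(∫∫ f(U) K̃_β(U,V) f(V)) · μ₀(L³β) ≤ e^{ελ_b(L³β)} · μ_k(L³β) · λ₀(β,L) · ∫ f² N`
(`K̃_β = avgKernel β` the gauge-averaged transfer kernel of `…GaugeSliceKernel`, `μ_j` the one-site levels).
THE ADMISSIBILITY of the tube: `TubeAdmissible L δ T` := each `T β` is measurable, and eventually (i) every configuration of the inner region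
`{orbitDist < δ β}` is moved INTO `T β` by a Haar-positive set of gauge transformations (`0 < N`), (ii) `N ≥ n₀(β) > 0` on `T β`.
THE THEOREM ★★★ `innerNoIntruderOneOrbitAt_of_tube : TubeAdmissible L δ T → TubeNoIntruderAt L T → InnerNoIntruderOneOrbitAt L δ` — by the EXACT gauge
slice identity (`…GaugeSlice`/`…GaugeSliceKernel`, `slice_package`): for invariant `Gᵢ` put `fᵢ = sliceFn 𝟙_T Gᵢ = Gᵢ𝟙_T/N`; then `Σaᵢfᵢ = sliceFn 𝟙_T (ΣaᵢGᵢ)`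
(`sliceFn_sum`), `⟨ΣaG, K_β ΣaG⟩ = ∫∫ (Σaf) K̃_β (Σaf)` and `‖ΣaG‖² = ∫ (Σaf)² N`, so the two min–max problems have the same Rayleigh quotients, word for word.
So C4-CORE = `TubeNoIntruderAt L T` for an admissible tube of one's choosing (§23.2: the orthographic constant-mode tube with a thin gauge-linear cut and
gauge-invariant action/core cuts; admissibility from `…OrthoTubeCoverage`); the remaining analysis (N-asymptotics = Faddeev–Popov determinant, `K̃_β` in the
tube, Feshbach in `(u; w, η)` with exact one-site Haar in `u` by `…SlowDisintegration`) never mentions gauge invariance again.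
HONEST FRAMING: an exact reduction for a stub of a child of the CONDITIONAL reduction route R2b1; `TubeNoIntruderAt` OPEN; not infinite volume, not a gap,
not Clay.
-/

set_option autoImplicit false

noncomputable section

open MeasureTheory Filter Topology Real
open scoped BigOperators
open Literature.MathematicalPhysics.QuantumFieldTheory
open Literature.MathematicalPhysics.QuantumLattice

namespace Summit.QuantumFields.YangMills.Theorems.FemtoTransferGap

open TwoLattice.Avg

variable {L : ℕ} [NeZero L]

/-! ## §1 The target texts -/

/-- The Faddeev–Popov weight of a tube: `N_T(U) = Haar{g : U^g ∈ T} = gaugeAvg 𝟙_T (U)`. [cite: SeilerLNP1982, §2] -/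
def tubeWeight (T : Set (GaugeConfig 3 L SU2)) : GaugeConfig 3 L SU2 → ℝ := gaugeAvg (T.indicator fun _ => (1 : ℝ))

variable (L) in
/-- **TUBE NO-INTRUDER** (target text; OPEN): for every `k`, `ε > 0`, eventually in `β`, every family of `k+1` bounded measurable functions supported in the tube
`T β`, nondegenerate in `L²(N_T dU)`, has a nonzero combination `f` with `(∫∫ f K̃_β f)·μ₀(L³β) ≤ e^{ελ_b(L³β)}·μ_k(L³β)·λ₀(β,L)·∫ f² N_T` — the min–max
comparison of the gauge-AVERAGED kernel on the tube with the one-site levels; NO gauge invariance is asked of the `fᵢ`. [cite: Luscher1983, §3] -/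
def TubeNoIntruderAt (T : ℝ → Set (GaugeConfig 3 L SU2)) : Prop :=
  ∀ k : ℕ, ∀ ε : ℝ, 0 < ε → ∃ β0 : ℝ, ∀ β : ℝ, β0 ≤ β →
    ∀ f : Fin (k + 1) → (GaugeConfig 3 L SU2 → ℝ),
      (∀ i, Measurable (f i)) → (∀ i, ∃ C : ℝ, ∀ U, |f i U| ≤ C) → (∀ i U, f i U ≠ 0 → U ∈ T β) →
      (∀ a : Fin (k + 1) → ℝ, a ≠ 0 → 0 < ∫ U, (∑ i, a i * f i U) ^ 2 * tubeWeight (T β) U ∂configMeasure SU2 L) →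
        ∃ a : Fin (k + 1) → ℝ, a ≠ 0 ∧
          (∫ U, ∫ V, (∑ i, a i * f i U) * avgKernel β U V * (∑ i, a i * f i V) ∂configMeasure SU2 L ∂configMeasure SU2 L) *
              levelValue su2Rep 1 ((L : ℝ) ^ 3 * β) 0 ≤
            Real.exp (ε * bareLambda ((L : ℝ) ^ 3 * β)) * levelValue su2Rep 1 ((L : ℝ) ^ 3 * β) k * levelValue su2Rep L β 0 *
              ∫ U, (∑ i, a i * f i U) ^ 2 * tubeWeight (T β) U ∂configMeasure SU2 L

variable (L) in
/-- **ADMISSIBLE TUBES** for the inner region `{orbitDist < δ}`: measurable, eventually reached from every inner configuration by a Haar-positive set of gauge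
transformations, and with Faddeev–Popov weight bounded below on the tube. [folklore] -/
def TubeAdmissible (δ : ℝ → ℝ) (T : ℝ → Set (GaugeConfig 3 L SU2)) : Prop :=
  (∀ β, MeasurableSet (T β)) ∧
    ∃ β1 : ℝ, ∀ β : ℝ, β1 ≤ β →
      (∀ U : GaugeConfig 3 L SU2, orbitDist U < δ β → 0 < tubeWeight (T β) U) ∧
        ∃ n₀ : ℝ, 0 < n₀ ∧ ∀ U ∈ T β, n₀ ≤ tubeWeight (T β) U

/-! ## §2 Elementary facts about the weight and finite combinations -/

omit [NeZero L] in
/-- The indicator of a set with value `1` is idempotent. [folklore] -/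
theorem indicator_one_mul_self (T : Set (GaugeConfig 3 L SU2)) (U : GaugeConfig 3 L SU2) :
    T.indicator (fun _ => (1 : ℝ)) U * T.indicator (fun _ => (1 : ℝ)) U = T.indicator (fun _ => (1 : ℝ)) U := by
  by_cases h : U ∈ T <;> simp [h]

omit [NeZero L] in
/-- `|𝟙_T| ≤ 1`. [folklore] -/
theorem abs_indicator_one_le (T : Set (GaugeConfig 3 L SU2)) (U : GaugeConfig 3 L SU2) : |T.indicator (fun _ => (1 : ℝ)) U| ≤ 1 := by
  by_cases h : U ∈ T <;> simp [h]

omit [NeZero L] in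
/-- A finite combination of measurable functions is measurable. [folklore] -/
theorem measurable_combination {k : ℕ} {G : Fin k → GaugeConfig 3 L SU2 → ℝ} (hG : ∀ i, Measurable (G i)) (a : Fin k → ℝ) :
    Measurable fun U => ∑ i, a i * G i U :=
  Finset.measurable_sum _ fun i _ => (hG i).const_mul (a i)

omit [NeZero L] in
/-- A finite combination of bounded functions is bounded. [folklore] -/
theorem bounded_combination {k : ℕ} {G : Fin k → GaugeConfig 3 L SU2 → ℝ} (hG : ∀ i, ∃ C : ℝ, ∀ U, |G i U| ≤ C) (a : Fin k → ℝ) :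
    ∃ C : ℝ, ∀ U, |∑ i, a i * G i U| ≤ C := by
  choose C hC using hG
  refine ⟨∑ i, |a i| * C i, fun U => (Finset.abs_sum_le_sum_abs _ _).trans (Finset.sum_le_sum fun i _ => ?_)⟩
  rw [abs_mul]; exact mul_le_mul_of_nonneg_left (hC i U) (abs_nonneg _)

omit [NeZero L] in
/-- A finite combination of gauge-invariant functions is gauge-invariant. [folklore] -/
theorem invariant_combination {k : ℕ} {G : Fin k → GaugeConfig 3 L SU2 → ℝ}
    (hG : ∀ i (g : Site 3 L → SU2) (U : GaugeConfig 3 L SU2), G i (gaugeTransform g U) = G i U) (a : Fin k → ℝ)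
    (g : Site 3 L → SU2) (U : GaugeConfig 3 L SU2) : (∑ i, a i * G i (gaugeTransform g U)) = ∑ i, a i * G i U := by
  simp_rw [hG]

omit [NeZero L] in
/-- If a finite combination is non-zero, some member is non-zero there. [folklore] -/
theorem exists_ne_zero_of_combination_ne_zero {k : ℕ} {G : Fin k → GaugeConfig 3 L SU2 → ℝ} {a : Fin k → ℝ} {U : GaugeConfig 3 L SU2}
    (h : (∑ i, a i * G i U) ≠ 0) : ∃ i, G i U ≠ 0 := by
  by_contra hne
  push Not at hne
  exact h (Finset.sum_eq_zero fun i _ => by rw [hne i, mul_zero])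

/-! ## §3 ★★★ The reduction -/

/-- ★★★ **C4 INNER ONE-ORBIT from TUBE NO-INTRUDER**: for an admissible tube, the min–max statement for the gauge-averaged kernel on the tube (no invariance)
implies `InnerNoIntruderOneOrbitAt L δ` — the two problems have identical Rayleigh quotients under `G ↦ sliceFn 𝟙_T G` (exact gauge slice identity).
[cite: Luscher1983, §3] -/
theorem innerNoIntruderOneOrbitAt_of_tube {δ : ℝ → ℝ} {T : ℝ → Set (GaugeConfig 3 L SU2)} (hT : TubeAdmissible L δ T) (hN : TubeNoIntruderAt L T) :
    InnerNoIntruderOneOrbitAt L δ := by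
  obtain ⟨hTm, β1, hβ1⟩ := hT
  intro k ε hε
  obtain ⟨β0, hβ0⟩ := hN k ε hε
  refine ⟨max β0 β1, fun β hβ G hGm hGb hGinv hGsupp hGind => ?_⟩
  have hβ0' : β0 ≤ β := (le_max_left _ _).trans hβ
  obtain ⟨hcov, n₀, hn₀, hNlow⟩ := hβ1 β ((le_max_right _ _).trans hβ)
  -- the weight and the slice functions
  set χ : GaugeConfig 3 L SU2 → ℝ := (T β).indicator fun _ => (1 : ℝ) with hχ_def
  have hχm : Measurable χ := (measurable_const.indicator (hTm β))
  have hχb : ∀ U, |χ U| ≤ 1 := abs_indicator_one_le (T β)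
  have hχidem : ∀ U, χ U * χ U = χ U := indicator_one_mul_self (T β)
  have hNχ : ∀ U, χ U ≠ 0 → n₀ ≤ gaugeAvg χ U := fun U hU => by
    have hUT : U ∈ T β := by
      by_contra h; exact hU (by simp [hχ_def, h])
    exact hNlow U hUT
  set f : Fin (k + 1) → GaugeConfig 3 L SU2 → ℝ := fun i => sliceFn χ (G i) with hf_def
  -- the combination `ψ_a = Σ aᵢ Gᵢ` and its slice function `Σ aᵢ fᵢ`
  have hψ : ∀ a : Fin (k + 1) → ℝ,
      Measurable (fun U => ∑ i, a i * G i U) ∧ (∃ C : ℝ, ∀ U, |∑ i, a i * G i U| ≤ C) ∧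
        (∀ (g : Site 3 L → SU2) (U : GaugeConfig 3 L SU2), (∑ i, a i * G i (gaugeTransform g U)) = ∑ i, a i * G i U) ∧
        (∀ U, (∑ i, a i * G i U) ≠ 0 → gaugeAvg χ U ≠ 0) := fun a =>
    ⟨measurable_combination hGm a, bounded_combination hGb a, invariant_combination hGinv a, fun U hU => by
      obtain ⟨i, hi⟩ := exists_ne_zero_of_combination_ne_zero hU
      exact (hcov U (hGsupp i U hi)).ne'⟩
  have hslice : ∀ a : Fin (k + 1) → ℝ, sliceFn χ (fun U => ∑ i, a i * G i U) = fun U => ∑ i, a i * f i U := fun a => sliceFn_sum χ a G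
  have hpack : ∀ a : Fin (k + 1) → ℝ,
      l2 (fun U => ∑ i, a i * G i U) (fun U => ∑ i, a i * G i U) = ∫ U, (∑ i, a i * f i U) ^ 2 * tubeWeight (T β) U ∂configMeasure SU2 L ∧
      qform su2Rep β (fun U => ∑ i, a i * G i U) (fun U => ∑ i, a i * G i U) =
        ∫ U, ∫ V, (∑ i, a i * f i U) * avgKernel β U V * (∑ i, a i * f i V) ∂configMeasure SU2 L ∂configMeasure SU2 L := fun a => by
    obtain ⟨hm, ⟨C, hC⟩, hinv, hcv⟩ := hψ a
    obtain ⟨-, -, -, h2, h1⟩ := slice_package β hχm hχb hχidem hn₀ hNχ hm hC hinv hcv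
    rw [hslice a] at h1 h2
    exact ⟨h2, h1⟩
  -- apply the tube statement to the slice functions
  have hfm : ∀ i, Measurable (f i) := fun i => measurable_sliceFn hχm (hGm i)
  have hfb : ∀ i, ∃ C : ℝ, ∀ U, |f i U| ≤ C := fun i => by
    obtain ⟨C, hC⟩ := hGb i
    exact ⟨C * 1 / n₀, abs_sliceFn_le hχb hC hn₀ hNχ⟩
  have hfsupp : ∀ i U, f i U ≠ 0 → U ∈ T β := fun i U hU => by
    have hχU := (sliceFn_ne_zero hU).1
    by_contra h; exact hχU (by simp [hχ_def, h])
  have hfind : ∀ a : Fin (k + 1) → ℝ, a ≠ 0 → 0 < ∫ U, (∑ i, a i * f i U) ^ 2 * tubeWeight (T β) U ∂configMeasure SU2 L := fun a ha => by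
    rw [← (hpack a).1]; exact hGind a ha
  obtain ⟨a, ha, hle⟩ := hβ0 β hβ0' f hfm hfb hfsupp hfind
  refine ⟨a, ha, ?_⟩
  rw [(hpack a).2, (hpack a).1]
  exact hle

end Summit.QuantumFields.YangMills.Theorems.FemtoTransferGap

end
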